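import Mathlib
import Summits.Ventures.PercRepro2.SwGlueP1
import Summits.Ventures.PercRepro2.SwGlueP1Main
import Summits.Ventures.PercRepro2.SwAllRow
import Summits.Ventures.PercRepro2.SwAllBlocks
import Summits.Ventures.PercRepro2.RigidLemma
import Summits.Ventures.PercRepro2.RigidSide

/-!
# Row 2′SW-ALL across a cut separating `{l, o}` from `h` — the seventh rigid placement
(blind cell PercRepro2, night-4 g6, 2026-08-24; proofs/NIGHT4-G6.md §2; NIGHT4-BRIDGE.md §11, §14)

`l, o` on the first side, `h` on the second, `c` the cut vertex.  The map is night-4 g4's nine-class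
map `Glue.glueMap` (SwGlueP1.lean) with RIGID ingredients: `φ` = the 2′SW-ALL permutation of
`Q(G₁; l, c, o)` (the hypothesis), `ψ` = the rigid side injection (RS) (`RigidSide.exists_rigidSide`),
`θ` = the rigid permutation of the blue side `{c ∈ C_B(h) ∖ C_R(h)}` of the second side — a
DECREASING class, so the rigid lemma `Rigid.exists_rigidPerm_of_isLowerSet` applies
(`exists_rigidBsidePerm`) — and the colour swap of the second side.  The red cluster of `h` in the
glued graph is `C_R²(h)`, plus `C_R¹(c)` when `c ∈ C_R²(h)` (`cluster_glue_h`), so its red edges are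
flipped as soon as the second side flips the red edges of `C_R²(h)` and, when `c ∈ C_R²(h)`, the first
side flips the red edges of `C_R¹(c)` (`rigid_glue`); on every leaf of the map this is what the
ingredients provide (`glueMap_mem_rigid`).  Membership in `Q(G)` and injectivity are g4's
(`glueMap_mem_dom` — rigidity implies domination — and `glueDec_glueMap`).
`swAll_glue_sep_lo`: 2′SW-ALL(G₁; l, c, o) ⟹ 2′SW-ALL(G; l, h, o).  With SwAllBlocks / SwAllBlocks2 /
SwAllBlocks3 all seven cut-vertex placements of the rigid row are now in the kernel.
-/

namespace Summit.Ventures.PercRepro2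

namespace Glue

open Hull LocRows SwSide

open scoped Classical

variable {V : Type*} {E₁ E₂ : Type*} {ends₁ : E₁ → Sym2 V} {ends₂ : E₂ → Sym2 V} {c : V}
  {V₁ V₂ : Set V}

/-! ## The rigid blue-side permutation `θ₂` -/

section Bside

variable {E : Type*} [Fintype E] [DecidableEq E] (ends : E → Sym2 V)

/-- `{c ∈ C_B(h) ∖ C_R(h)}` is decreasing. -/
lemma isLowerSet_bsideSet (c h : V) : IsLowerSet (↑(bsideSet ends c h) : Set (Config E)) := by
  intro ζ ζ' hle hζ
  simp only [Finset.mem_coe, bsideSet, Finset.mem_filter, Finset.mem_univ, true_and] at hζ ⊢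
  refine ⟨cluster_mono (Rigid.blue_antitone hle) h hζ.1, fun hc => hζ.2 (cluster_mono hle h hc)⟩

omit [DecidableEq E] in
/-- The red edges inside `C_R(h)` are red. -/
lemma redIn_subset_redF (h : V) (ζ : Config E) : RigidSide.redIn ends h ζ ⊆ Rigid.redF ζ := by
  intro e he
  rw [RigidSide.mem_redIn] at he
  exact Rigid.mem_redF.2 he.2

omit [DecidableEq E] in
/-- The red edges inside `C_R(h)` grow with the red set. -/
lemma redIn_mono (h : V) {ζ ζ' : Config E} (hle : ζ ≤ ζ') :
    RigidSide.redIn ends h ζ ⊆ RigidSide.redIn ends h ζ' := by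
  intro e he
  rw [RigidSide.mem_redIn] at he ⊢
  obtain ⟨⟨x, hx, y, hy, hends⟩, hred⟩ := he
  refine ⟨⟨x, cluster_mono hle h hx, y, cluster_mono hle h hy, hends⟩, ?_⟩
  have := hle e; rw [hred] at this; exact Bool.le_iff_imp.1 this rfl

/-- **The rigid blue-side permutation**: a permutation of `{c ∈ C_B(h) ∖ C_R(h)}` under which every
red edge inside `C_R(h)` is blue in the image (the rigid lemma on a decreasing class). -/
theorem exists_rigidBsidePerm (c h : V) :
    ∃ θ : {ζ // ζ ∈ bsideSet ends c h} → Config E, Function.Injective θ ∧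
      ∀ y, θ y ∈ bsideSet ends c h ∧
        ∀ e, e ∈ within ends (cluster ends y.1 h) → y.1 e = true → θ y e = false := by
  obtain ⟨f, hf, hmem⟩ := Rigid.exists_rigidPerm_of_isLowerSet (bsideSet ends c h)
    (isLowerSet_bsideSet ends c h) (RigidSide.redIn ends h) (redIn_subset_redF ends h)
    (fun ζ ζ' hle => redIn_mono ends h hle)
  refine ⟨f, hf, fun y => ⟨(hmem y).1, fun e he hred => (hmem y).2 e ?_⟩⟩
  exact (RigidSide.mem_redIn ends).2 ⟨he, hred⟩

end Bside

/-! ## Rigidity across the cut -/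

/-- A vertex of the second side in the glued cluster of `h ∈ V₂` is in the `G₂`-cluster of `h`. -/
lemma mem_cluster₂_of_mem_glue (hg : IsGluing ends₁ ends₂ c V₁ V₂) {h : V} (hh : h ∈ V₂)
    {ζ : Config (E₁ ⊕ E₂)} {x : V} (hx : x ∈ cluster (glue ends₁ ends₂) ζ h) (hxV : x ∈ V₂) :
    x ∈ cluster ends₂ (ζ ∘ Sum.inr) h := by
  rw [cluster_glue_eq₂ hg hh] at hx
  rcases hx with hx | ⟨hc, hx₁⟩
  · exact hx
  · have hxV₁ : x ∈ V₁ := cluster_subset_of_mem hg hg.c_mem₁ hx₁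
    rw [hg.inter x hxV₁ hxV]; exact hc

/-- A vertex of the first side in the glued cluster of `h ∈ V₂` lies in the `G₁`-cluster of `c`, and
`c` is in the `G₂`-cluster of `h`. -/
lemma mem_cluster₁_of_mem_glue (hg : IsGluing ends₁ ends₂ c V₁ V₂) {h : V} (hh : h ∈ V₂)
    {ζ : Config (E₁ ⊕ E₂)} {x : V} (hx : x ∈ cluster (glue ends₁ ends₂) ζ h) (hxV : x ∈ V₁) :
    c ∈ cluster ends₂ (ζ ∘ Sum.inr) h ∧ x ∈ cluster ends₁ (ζ ∘ Sum.inl) c := by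
  rw [cluster_glue_eq₂ hg hh] at hx
  rcases hx with hx | ⟨hc, hx₁⟩
  · have hxV₂ : x ∈ V₂ := cluster_subset_of_mem₂ hg hh hx
    have hxc : x = c := hg.inter x hxV hxV₂
    subst hxc
    exact ⟨hx, mem_cluster_self _ _ _⟩
  · exact ⟨hc, hx₁⟩

/-- **Rigidity across the cut**: if the second side of `z` flips every red edge inside `C_R²(h)` of
`ζ`, and — whenever `c ∈ C_R²(h)` — the first side flips every red edge inside `C_R¹(c)`, then `z`
flips every red edge inside the glued red cluster of `h`. -/
lemma rigid_glue (hg : IsGluing ends₁ ends₂ c V₁ V₂) {h : V} (hh : h ∈ V₂)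
    {ζ z : Config (E₁ ⊕ E₂)}
    (h₂ : ∀ e, e ∈ within ends₂ (cluster ends₂ (ζ ∘ Sum.inr) h) → (ζ ∘ Sum.inr) e = true →
      z (Sum.inr e) = false)
    (h₁ : c ∈ cluster ends₂ (ζ ∘ Sum.inr) h →
      ∀ e, e ∈ within ends₁ (cluster ends₁ (ζ ∘ Sum.inl) c) → (ζ ∘ Sum.inl) e = true →
        z (Sum.inl e) = false) :
    ∀ e, e ∈ within (glue ends₁ ends₂) (cluster (glue ends₁ ends₂) ζ h) → ζ e = true →
      z e = false := by
  intro e he hred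
  rcases e with e₁ | e₂
  · obtain ⟨x, ⟨hx, hxV⟩, y, ⟨hy, hyV⟩, hends⟩ := mem_within_inl_glue hg he
    obtain ⟨hc, hx₁⟩ := mem_cluster₁_of_mem_glue hg hh hx hxV
    obtain ⟨_, hy₁⟩ := mem_cluster₁_of_mem_glue hg hh hy hyV
    exact h₁ hc e₁ ⟨x, hx₁, y, hy₁, hends⟩ hred
  · obtain ⟨x, ⟨hx, hxV⟩, y, ⟨hy, hyV⟩, hends⟩ := mem_within_inr_glue hg he
    exact h₂ e₂ ⟨x, mem_cluster₂_of_mem_glue hg hh hx hxV, y,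
      mem_cluster₂_of_mem_glue hg hh hy hyV, hends⟩ hred

/-- The swapped second side of a pair flips its red edges. -/
lemma pair_blue_inr_apply (ζ₁ : Config E₁) (w : Config E₂) (e : E₂) (h : w e = true) :
    pair ζ₁ (blue w) (Sum.inr e) = false := by
  show blue w e = false
  rw [blue_apply, h]; rfl

variable [Fintype E₁] [Fintype E₂] [DecidableEq E₁] [DecidableEq E₂]

section Main

variable {hg : IsGluing ends₁ ends₂ c V₁ V₂} {l h o : V} {hl : l ∈ V₁} {ho : o ∈ V₁} {hoc : o ≠ c}
  {hh : h ∈ V₂} {hhc : h ≠ c}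
  {φ : {ζ // ζ ∈ tgtU ends₁ l c {S : Set V | o ∈ S}} → Config E₁}
  {ψ : {ζ // ζ ∈ srcSide ends₁ l c o} → Config E₁}
  {θ : {ζ // ζ ∈ bsideSet ends₂ c h} → Config E₂}

/-- **The image lies in `Q(G)` and is rigid** on every leaf: with rigid `φ`, `ψ`, `θ` the map flips
every red edge inside the glued red cluster of `h`. -/
theorem glueMap_mem_rigid
    (hmemφ : ∀ y, φ y ∈ tgtU ends₁ l c {S : Set V | o ∈ S} ∧
      ∀ e, e ∈ within ends₁ (cluster ends₁ y.1 c) → y.1 e = true → φ y e = false)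
    (hmemψ : ∀ y, ψ y ∈ tgtSide ends₁ l c o ∧
      ∀ e, e ∈ within ends₁ (cluster ends₁ y.1 c) → y.1 e = true → ψ y e = false)
    (hmemθ : ∀ y, θ y ∈ bsideSet ends₂ c h ∧
      ∀ e, e ∈ within ends₂ (cluster ends₂ y.1 h) → y.1 e = true → θ y e = false)
    (x : {ζ // ζ ∈ tgtU (glue ends₁ ends₂) l h {S : Set V | o ∈ S}}) :
    glueMap hg hl ho hoc hh hhc φ ψ θ x ∈ tgtU (glue ends₁ ends₂) l h {S : Set V | o ∈ S} ∧
      ∀ e, e ∈ within (glue ends₁ ends₂) (cluster (glue ends₁ ends₂) x.1 h) → x.1 e = true →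
        glueMap hg hl ho hoc hh hhc φ ψ θ x e = false := by
  refine ⟨(glueMap_mem_dom
    (fun y => ⟨(hmemφ y).1, cluster_subset_of_red_flipped ends₁ (hmemφ y).2⟩)
    (fun y => ⟨(hmemψ y).1, cluster_subset_of_red_flipped ends₁ (hmemψ y).2⟩)
    (fun y => ⟨(hmemθ y).1, cluster_subset_of_red_flipped ends₂ (hmemθ y).2⟩) x).1, ?_⟩
  have key := mem_tgtU_sep_lo hg hl ho hoc hh hhc
  obtain ⟨⟨hc1, hc2⟩, _, _⟩ := (key x.1).1 x.2
  by_cases hA : c ∈ cluster ends₁ (x.1 ∘ Sum.inl) l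
  · have hT : c ∉ cluster ends₂ (x.1 ∘ Sum.inr) h := fun hT => hc1 ⟨hA, hT⟩
    by_cases hB : c ∈ cluster ends₁ (blue (x.1 ∘ Sum.inl)) l
    · -- (K, n)
      rw [glueMap_KN x hA hB]
      exact rigid_glue hg hh (fun e _ hred => swap₂_inr_apply x.1 e hred) (fun hc => absurd hc hT)
    · by_cases hT' : c ∈ cluster ends₂ (blue (x.1 ∘ Sum.inr)) h
      · by_cases hr : ∃ s, ψ s = x.1 ∘ Sum.inl
        · -- (R, b) inside the image of `ψ`
          rw [glueMap_RB_in x hA hB hT' hr]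
          exact rigid_glue hg hh (fun e _ hred => pair_blue_inr_apply _ _ e hred)
            (fun hc => absurd hc hT)
        · -- (R, b) off the image of `ψ`: the rigid blue-side permutation
          rw [glueMap_RB_out x hA hB hT' hr]
          refine rigid_glue hg hh (fun e he hred => ?_) (fun hc => absurd hc hT)
          exact (hmemθ ⟨x.1 ∘ Sum.inr, mem_bsideSet_of hg hl ho hoc hh hhc x.2 hA hT'⟩).2 e he hred
      · -- (R, n)
        rw [glueMap_RN x hA hB hT']
        exact rigid_glue hg hh (fun e _ hred => swap₂_inr_apply x.1 e hred) (fun hc => absurd hc hT)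
  · by_cases hB : c ∈ cluster ends₁ (blue (x.1 ∘ Sum.inl)) l
    · by_cases hT : c ∈ cluster ends₂ (x.1 ∘ Sum.inr) h
      · -- (B, r): the rigid side injection on the first side
        rw [glueMap_BR x hA hB hT]
        refine rigid_glue hg hh (fun e _ hred => pair_blue_inr_apply _ _ e hred) (fun _ e he hred => ?_)
        exact (hmemψ ⟨x.1 ∘ Sum.inl, mem_srcSide_of hg hl ho hoc hh hhc x.2 hA hB⟩).2 e he hred
      · -- (B, n)
        rw [glueMap_BN x hA hB hT]
        exact rigid_glue hg hh (fun e _ hred => swap₂_inr_apply x.1 e hred) (fun hc => absurd hc hT)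
    · by_cases hT : c ∈ cluster ends₂ (x.1 ∘ Sum.inr) h
      · -- (N, T): the rigid permutation of `Q(G₁; l, c, o)` on the first side
        rw [glueMap_NT x hA hB hT]
        refine rigid_glue hg hh (fun e _ hred => pair_blue_inr_apply _ _ e hred) (fun _ e he hred => ?_)
        exact (hmemφ ⟨x.1 ∘ Sum.inl, mem_tgtU₁_of hg hl ho hoc hh hhc x.2 hA hB⟩).2 e he hred
      · -- (N, ¬T)
        rw [glueMap_NN x hA hB hT]
        exact rigid_glue hg hh (fun e _ hred => swap₂_inr_apply x.1 e hred) (fun hc => absurd hc hT)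

end Main

/-- **2′SW-ALL across a cut separating `{l, o}` from `h`**: the rigid row on the `{l, o}`-side with
the cut vertex as the marked `h` gives the rigid row on the glued graph; the other ingredients — the
rigid side injection (RS) and the rigid blue-side permutation — are theorems. -/
theorem swAll_glue_sep_lo (hg : IsGluing ends₁ ends₂ c V₁ V₂) {l h o : V} (hl : l ∈ V₁) (ho : o ∈ V₁)
    (hoc : o ≠ c) (hh : h ∈ V₂) (hhc : h ≠ c) (h₁ : SwAll ends₁ l c o) :
    SwAll (glue ends₁ ends₂) l h o := by
  obtain ⟨φ, hφ, hmemφ⟩ := h₁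
  obtain ⟨ψ₀, hψ₀, hmemψ₀⟩ := RigidSide.exists_rigidSide ends₁ l c o
  obtain ⟨θ, hθ, hmemθ⟩ := exists_rigidBsidePerm ends₂ c h
  -- `RigidSide.srcRS` / `tgtRS` are `SwSide.srcSide` / `tgtSide` by definition
  let ψ : {ζ // ζ ∈ srcSide ends₁ l c o} → Config E₁ := fun y => ψ₀ ⟨y.1, y.2⟩
  have hψ : Function.Injective ψ := by
    intro y₁ y₂ hy
    have := hψ₀ hy
    exact Subtype.ext (congrArg Subtype.val this)
  have hmemψ : ∀ y, ψ y ∈ tgtSide ends₁ l c o ∧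
      ∀ e, e ∈ within ends₁ (cluster ends₁ y.1 c) → y.1 e = true → ψ y e = false :=
    fun y => hmemψ₀ ⟨y.1, y.2⟩
  refine ⟨glueMap hg hl ho hoc hh hhc φ ψ θ, ?_, glueMap_mem_rigid hmemφ hmemψ hmemθ⟩
  intro x y hxy
  apply Subtype.ext
  have hd := glueDec_glueMap (hg := hg) (hl := hl) (ho := ho) (hoc := hoc) (hh := hh) (hhc := hhc)
    (φ := φ) (ψ := ψ) (θ := θ)
  rw [← hd x hφ (fun y => (hmemφ y).1) hψ (fun y => (hmemψ y).1) hθ (fun y => (hmemθ y).1), hxy,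
    hd y hφ (fun y => (hmemφ y).1) hψ (fun y => (hmemψ y).1) hθ (fun y => (hmemθ y).1)]

end Glue

end Summit.Ventures.PercRepro2
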